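import Summits.NavierStokesRegularity.FluidComputer.GateBudgetLadder
import HarnessLib

/-!
# What no tuning can beat, part 68: THE DUD HORIZON — the two budgets of part 64's misfire
# ladder discharged in closed form: the headline member's output gate obeys `ã ≤ 0.1415` on
# `[0, 1.8282 + K⁹/(200k + 80000K)]`, i.e. Tao's delay machine started from `delayInit` does not
# fire before time `≈ 1.25·10⁻⁵K⁸` at every fixed lattice index `k` (`5.4·10⁴` at `K = 16`,
# `1.2·10¹¹` at `K = 100`) (SPEC-INPUT-bp1 §AW/§BD)

Cell `pub-fluidc`, blueprint seat bp1 (gen 35, seventh item, file 1 of 2); same namespace and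
conventions as parts 1–67 (`GateBudget*.lean`); imports part 64 (`GateBudgetLadder`: §201
`knob_ladder_no_output`; through it part 63 §196 `rung_numerics`).
Headline knob family `rotorCircuit K K¹⁰ ε ρ` from (5.6) (modes `0 = a`, `1 = b` clock, `2 = c`
trigger, `3 = d`, `4 = ã` output), a trigger primitive `C` (`C' = c`), the lattice `ε = kK¹⁰ρ²`
on the window `200ε/K²⁰ ≤ ρ² ≤ 2ε/K¹⁰`, `δ₀ = kπ/((25/16 - 10⁻⁶)K¹⁰ - 1) + 1/K¹⁹`. HONEST
FRAMING (verbatim): low prior, high value-of-information experiment on Tao's machine paradigm;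
NOT a claim that NS blows up. Nothing is proved about the Navier–Stokes equations.

## Why (SPEC-INPUT-bp1 §AW: one quotable statement instead of two budget hypotheses)

Part 64 §201 `knob_ladder_no_output` carries its budgets as hypotheses on a natural number `N`:
the clock budget `(N - 1)·286/K⁹ ≤ 0.144` and the pair budget `0.00806 + N·s ≤ 1/50` with
`s = 0.3(δ₀ + 1210/K⁸) + 6/K⁹`. This file chooses `N := ⌊x⌋₊ + 1`, `x := K⁹/(200k + 80000K)`,
and verifies both by elementary estimates: the identity `200·xk + 80000·xK = K⁹` gives
`xk ≤ K⁹/200` and `x ≤ K⁸/80000`; with `D := (25/16 - 10⁻⁶)K¹⁰ - 1 ≥ K¹⁰ ≥ 16K⁹` and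
`π < 3.15` this yields `x·kπ/D ≤ 10⁻³`, `x/K¹⁹ ≤ x/K⁸ ≤ 1/80000`, `1210x/K⁸ ≤ 0.015125`,
`6x/K⁹ ≤ 6x/K⁸ ≤ 0.000075`, hence `x·s ≤ 0.005`; part 63 §196 gives `s ≤ 0.3·0.0171 + 6/K⁹ ≤
0.005131`; so `0.00806 + (x + 1)s ≤ 0.0182 ≤ 1/50`, and `⌊x⌋₊·286/K⁹ ≤ 286x/K⁸ ≤ 0.0036`.

## What is proved

* §211 `horizon_numerics`: `0 ≤ x`, `x ≤ ⌊x⌋₊ + 1`, and both budgets of part 64 §201 at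
  `N := ⌊x⌋₊ + 1` (stated with the cast `((⌊x⌋₊ + 1 : ℕ) : ℝ)` exactly as §201 consumes them).
* §212 `knob_dud_horizon` (THE DUD HORIZON): for the headline member from `delayInit` with a
  trigger primitive, `K ≥ 16`, `0 < ε`, `ε² ≤ 1/(6K²⁰)`, `0 < ρ`, `200ε/K²⁰ ≤ ρ²`, `K¹⁰ρ² ≤ 2ε`,
  `ε = kK¹⁰ρ²`: `∀ t ∈ [0, 1.8282 + K⁹/(200k + 80000K)]`, `ã(t) ≤ 0.1415`.

HONEST LIMITS. (i) `K⁹/(200k + 80000K)` is a convenient UNDER-estimate of part 64's budget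
`N ≤ 0.01194/s` (`≈ 3.3·10⁻⁵K⁸` at small `k`; the closed form keeps `≈ 40 %` of it); at the
top of the lattice window (`k ≍ K¹⁰/200`) it is `< 1` and the statement says no more than part
49 (`N = 1`, horizon `< 2.83`); the fine ladder of parts 65–67 gives `K⁹/(200(k + 100 log K))`
(file 2); (ii) every limit of part 64 stands (headline family `M = K¹⁰`, `K ≥ 16`, lattice
`ε = kK¹⁰ρ²` only; anchor `P₁ ≤ 0.00806` from part 49); (iii) it is NOT a statement that the
machine never fires — nothing is claimed after the horizon; (iv) nothing about Navier–Stokes.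
[cite: Tao2016AveragedNS, §5.5 Theorem 5.3, (5.5), (5.6), (b-eq), (c-eq), (ta-eq), (energy-con)]
-/

noncomputable section

namespace Summit.NavierStokesRegularity.FluidComputer.GateBudget

open Real Set
open Literature.Analysis.FluidPDE.Tao2016AveragedNS

variable {K ε ρ : ℝ} {X : ℝ → Fin 5 → ℝ}

/-! ## §211 Horizon numerics -/

/-- §211 HORIZON NUMERICS. `K ≥ 16`, `0 < ε`, `0 < ρ`, `200ε/K²⁰ ≤ ρ²`, `ε = kK¹⁰ρ²`,
`x = K⁹/(200k + 80000K)` ⇒ `0 ≤ x`, `x ≤ ⌊x⌋₊ + 1`, the clock budget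
`(⌊x⌋₊ + 1 - 1)·286/K⁹ ≤ 0.144` and the pair budget
`0.00806 + (⌊x⌋₊ + 1)·(0.3(δ₀ + 1210/K⁸) + 6/K⁹) ≤ 1/50` of part 64 §201.
[derived: part 63 §196 `rung_numerics`, part 9 `headline_pow_floor`, `Nat.floor_le`,
`Nat.lt_floor_add_one`, `Real.pi_lt_d2`] -/
theorem horizon_numerics (hK : 16 ≤ K) (hε : 0 < ε) (hρ : 0 < ρ)
    (hlo : 200 * ε / K ^ 20 ≤ ρ ^ 2) (k : ℕ) (hk : ε = k * K ^ 10 * ρ ^ 2) {x : ℝ}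
    (hx : x = K ^ 9 / (200 * k + 80000 * K)) :
    0 ≤ x ∧ x ≤ ((⌊x⌋₊ + 1 : ℕ) : ℝ) ∧
      (((⌊x⌋₊ + 1 : ℕ) : ℝ) - 1) * (286 / K ^ 9) ≤ 144 / 1000 ∧
      806 / 100000 + ((⌊x⌋₊ + 1 : ℕ) : ℝ) * (3 * (k * π / ((25 / 16 - 1 / 10 ^ 6) * K ^ 10
        - 1) + 1 / K ^ 19 + 1210 / K ^ 8) / 10 + 6 / K ^ 9) ≤ 1 / 50 := by
  obtain ⟨-, -, hD0, hδ0, hη, -⟩ := rung_numerics hK hε hρ hlo k hk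
  have hK0 : (0 : ℝ) < K := by linarith
  have hK1 : (1 : ℝ) ≤ K := by linarith
  have hK8 : (0 : ℝ) < K ^ 8 := by positivity
  have hK9 : (0 : ℝ) < K ^ 9 := by positivity
  have hk0 : (0 : ℝ) ≤ k := Nat.cast_nonneg k
  obtain ⟨D, hD_def⟩ : ∃ D : ℝ, D = (25 / 16 - 1 / 10 ^ 6) * K ^ 10 - 1 := ⟨_, rfl⟩
  simp only [← hD_def] at hD0 hδ0 hη ⊢
  -- the defining identity of `x` and its linear consequences
  have hA0 : (0 : ℝ) < 200 * k + 80000 * K := by positivity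
  have hx0 : 0 ≤ x := by rw [hx]; positivity
  have hxA : 200 * (x * k) + 80000 * (x * K) = K ^ 9 := by
    have e : x * (200 * k + 80000 * K) = K ^ 9 := by
      rw [hx]; exact div_mul_cancel₀ _ hA0.ne'
    rw [← e]; ring
  have hxk : x * k ≤ K ^ 9 / 200 := by
    have : 0 ≤ x * K := mul_nonneg hx0 hK0.le
    linarith
  have hxle : x ≤ K ^ 8 / 80000 := by
    rw [hx]
    calc K ^ 9 / (200 * k + 80000 * K) ≤ K ^ 9 / (80000 * K) :=
          div_le_div_of_nonneg_left hK9.le (by positivity) (by linarith)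
      _ = K ^ 8 / 80000 := by rw [div_eq_div_iff (by positivity) (by norm_num)]; ring
  have hx8 : x * (1 / K ^ 8) ≤ 1 / 80000 :=
    calc x * (1 / K ^ 8) ≤ K ^ 8 / 80000 * (1 / K ^ 8) :=
          mul_le_mul_of_nonneg_right hxle (by positivity)
      _ = 1 / 80000 := by
          rw [div_mul_div_comm, div_eq_div_iff (by positivity) (by norm_num)]; ring
  -- floor facts and the cast of `⌊x⌋₊ + 1`
  have hfl : (⌊x⌋₊ : ℝ) ≤ x := Nat.floor_le hx0
  have hfl' : x < (⌊x⌋₊ : ℝ) + 1 := Nat.lt_floor_add_one x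
  have hcast : ((⌊x⌋₊ + 1 : ℕ) : ℝ) = (⌊x⌋₊ : ℝ) + 1 := by push_cast; ring
  rw [hcast]
  -- monotonicity in the exponent
  have hpow9 : K ^ 8 ≤ K ^ 9 := pow_le_pow_right₀ hK1 (by norm_num)
  have hpow19 : K ^ 8 ≤ K ^ 19 := pow_le_pow_right₀ hK1 (by norm_num)
  have h19 : 1 / K ^ 19 ≤ 1 / K ^ 8 := one_div_le_one_div_of_le hK8 hpow19
  have h286 : 286 / K ^ 9 ≤ 286 / K ^ 8 := div_le_div_of_nonneg_left (by norm_num) hK8 hpow9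
  have h6 : 6 / K ^ 9 ≤ 6 / K ^ 8 := div_le_div_of_nonneg_left (by norm_num) hK8 hpow9
  -- the four products `x·(term)`
  have hDK : K ^ 10 ≤ D := by
    have h2 : (16 : ℝ) ^ 10 ≤ K ^ 10 := headline_pow_floor hK 10
    rw [hD_def]; linarith [h2]
  have hK10 : 16 * K ^ 9 ≤ K ^ 10 := by
    have e : K ^ 10 = K * K ^ 9 := by ring
    rw [e]; exact mul_le_mul_of_nonneg_right hK hK9.le
  have hT1 : x * (k * π / D) ≤ 1 / 1000 := by
    have e : x * (k * π / D) = x * k * π / D := by ring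
    rw [e, div_le_iff₀ hD0]
    have h1 : x * k * π ≤ K ^ 9 / 200 * 3.15 :=
      mul_le_mul hxk Real.pi_lt_d2.le Real.pi_pos.le (by positivity)
    linarith [h1, hDK, hK10]
  have hT2 : x * (1 / K ^ 19) ≤ 1 / 80000 := (mul_le_mul_of_nonneg_left h19 hx0).trans hx8
  have hT3 : x * (1210 / K ^ 8) ≤ 1210 / 80000 := by
    have e : x * (1210 / K ^ 8) = 1210 * (x * (1 / K ^ 8)) := by ring
    rw [e]; linarith [hx8]
  have hT4 : x * (6 / K ^ 9) ≤ 6 / 80000 := by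
    have e : x * (6 / K ^ 8) = 6 * (x * (1 / K ^ 8)) := by ring
    have h := mul_le_mul_of_nonneg_left h6 hx0
    rw [e] at h; linarith [hx8]
  -- the increment `s` itself: `s ≤ 0.3·0.0171 + 6/K⁹`, `6/K⁹ ≤ 6/16⁹ ≤ 10⁻⁹`
  have h6K : 6 / K ^ 9 ≤ 1 / 10 ^ 9 :=
    (div_le_div_of_nonneg_left (by norm_num) (by positivity)
      (headline_pow_floor hK 9)).trans (by norm_num)
  have h6K0 : (0 : ℝ) ≤ 6 / K ^ 9 := by positivity
  have h1210 : (0 : ℝ) ≤ 1210 / K ^ 8 := by positivity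
  obtain ⟨S, hS_def⟩ : ∃ S : ℝ, S = 3 * (k * π / D + 1 / K ^ 19 + 1210 / K ^ 8) / 10
      + 6 / K ^ 9 := ⟨_, rfl⟩
  have hS0 : 0 ≤ S := by rw [hS_def]; linarith only [hδ0, h1210, h6K0]
  have hSle : S ≤ 5131 / 1000000 := by rw [hS_def]; linarith only [hη, h6K]
  have hxS : x * S ≤ 1 / 200 := by
    have e : x * S = 3 / 10 * (x * (k * π / D)) + 3 / 10 * (x * (1 / K ^ 19))
        + 3 / 10 * (x * (1210 / K ^ 8)) + x * (6 / K ^ 9) := by rw [hS_def]; ring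
    rw [e]; linarith only [hT1, hT2, hT3, hT4]
  simp only [← hS_def]
  refine ⟨hx0, hfl'.le, ?_, ?_⟩
  · -- clock budget: `⌊x⌋₊·286/K⁹ ≤ x·286/K⁸ ≤ 286/80000`
    have e : ((⌊x⌋₊ : ℝ) + 1 - 1) * (286 / K ^ 9) = (⌊x⌋₊ : ℝ) * (286 / K ^ 9) := by ring
    rw [e]
    have h1 : (⌊x⌋₊ : ℝ) * (286 / K ^ 9) ≤ x * (286 / K ^ 8) :=
      mul_le_mul hfl h286 (by positivity) hx0
    have e2 : x * (286 / K ^ 8) = 286 * (x * (1 / K ^ 8)) := by ring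
    rw [e2] at h1; linarith only [h1, hx8]
  · -- pair budget: `(⌊x⌋₊ + 1)s ≤ (x + 1)s = xs + s ≤ 0.005 + 0.005131`
    have hmono : ((⌊x⌋₊ : ℝ) + 1) * S ≤ (x + 1) * S :=
      mul_le_mul_of_nonneg_right (by linarith only [hfl]) hS0
    have e : (x + 1) * S = x * S + S := by ring
    linarith only [hmono, hxS, hSle, e]

/-! ## §212 The dud horizon -/

/-- §212 THE DUD HORIZON (part 64 §201 with its budgets discharged). For the headline member
`X` from `delayInit` with a trigger primitive `C`, `K ≥ 16`, `0 < ε`, `ε² ≤ 1/(6K²⁰)`, `0 < ρ`,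
the lattice window `200ε/K²⁰ ≤ ρ²`, `K¹⁰ρ² ≤ 2ε` and the lattice `ε = kK¹⁰ρ²`: the output gate
obeys `ã(t) ≤ 0.1415` for all `t ∈ [0, 1.8282 + K⁹/(200k + 80000K)]` — the machine does not
fire before time `≈ 1.25·10⁻⁵K⁸` at every fixed lattice index `k` (a firing machine drives
`ã` to `1`). Nothing is claimed after the horizon.
[derived: part 64 §201 `knob_ladder_no_output` at `N := ⌊K⁹/(200k + 80000K)⌋₊ + 1`, §211] -/
theorem knob_dud_horizon
    (hX : ∀ t, HasDerivAt X (RotorKnob.rotorCircuit K (K ^ 10) ε ρ (X t)) t)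
    (h0 : X 0 = delayInit) {C : ℝ → ℝ} (hC : ∀ t, HasDerivAt C (X t 2) t) (hK : 16 ≤ K)
    (hε : 0 < ε) (hεK : ε ^ 2 ≤ 1 / (6 * K ^ 20)) (hρ : 0 < ρ)
    (hlo : 200 * ε / K ^ 20 ≤ ρ ^ 2) (hhi : K ^ 10 * ρ ^ 2 ≤ 2 * ε) (k : ℕ)
    (hk : ε = k * K ^ 10 * ρ ^ 2) :
    ∀ t ∈ Icc (0 : ℝ) (18282 / 10000 + K ^ 9 / (200 * k + 80000 * K)),
      X t 4 ≤ 1415 / 10000 := by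
  intro t ht
  obtain ⟨-, hxN, hNθ, hNP⟩ :=
    horizon_numerics hK hε hρ hlo k hk (x := K ^ 9 / (200 * k + 80000 * K)) rfl
  exact knob_ladder_no_output hX h0 hC hK hε hεK hρ hlo hhi k hk
    (⌊K ^ 9 / (200 * k + 80000 * K)⌋₊ + 1) (Nat.le_add_left 1 _) hNθ hNP t
    ⟨ht.1, by linarith only [ht.2, hxN]⟩

end Summit.NavierStokesRegularity.FluidComputer.GateBudget

end
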